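import Literature.NumberTheory.Automorphic.TateLocalFactors
import HarnessLib

/-!
# Stub-ideation k = 1 (gen 9) for `stub_heegnerIndexLowerAtTwo` — crux `PrintCf2.SplitBadTwoLowerHalfOfFacts`
# (stmt-BirchSwinnertonDyer-27851), technique «weaken / strengthen»: **K1 OF ARM M AS LOCAL TYPE** (STUB-PLAN v2.3 R70)

Arm M (k1-g8, T3.6) needs `δ`-RIGIDITY of the dyadic NET digit `e(W)` on the class `cm7^{(d)}`, `d ≢ 1 (4)`:
`e` is invariant under the UNRAMIFIED quadratic twist at `2` (`d ↦ 5d` in `ℚ₂ˣ/ℚ₂ˣ²`).  This file types the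
MECHANISM behind it and its weakest sufficient / strongest provable forms:

* §A the LOCAL DATUM at `v ∣ 2` of a member: the unit character `(d, ·)₂|_{ℤ₂ˣ}` (Serre's formula) and its
  conductor exponent; PROVED: it is `δ`-invariant and takes three values `χ₋₄, χ₈, χ₋₈` (`n_v = 2, 3, 3`);
* §B LOCAL TYPE: a digit family that factors through the local datum is `δ`-rigid, sums of local-type families
  are local type, and local type ⟺ `δ`-rigidity (so «local type» is exactly the PROVABLE FORM of K1);
* §C the STRONGEST PROVABLE forms of R70 (i)–(iii) over the tree's Tate local API, for ANY non-archimedean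
  local field: (iii) `a(χω) = a(χ)` and (ii) `P_{χω} = P_χ = 1` PROVED; (i) `ε(χω, ψ) = ω(ϖ)^{a(χ)−m(ψ)} ε(χ, ψ)`
  stated as a named `Prop` over `HasTateEpsilon` (Kudla, Prop. 3.8(ii) / (3.28); Deligne 1973 (5.5.3)), with the
  digit corollary `(ω(ϖ)^k)² = 1` for quadratic `ω` PROVED;
* §D the WEAKEST SUFFICIENT form for the `≤`-half: LOWER consumes only a one-sided floor `T(δ(W)) ≤ e(W)`
  (lower semi-rigidity from the anchor), PROVED end-to-end with slack 3; a residual integral family that is a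
  unit at the anchor needs no rigidity at all; and SHAPE⁺ = SHAPE with «`G_W(0) ≠ 0` per member» EXPLICIT
  (print since STUB-PLAN v2.4: Burungale–Skinner 2026, arXiv:2603.20886, Thm 2.5 / 2.9 / §2.3.1, any `p`);
* §E R58's re-typing half (T1-AT arm): k1-g7's one-sided R3 as an EQUALITY with a defect binder `δ_N` plus the
  sign `0 ≤ δ_N` (PROVED equivalent — the sign is the whole research content LOWER consumes), and R2 with the
  finiteness of the twisted Selmer group as a CONCLUSION (`WithTop ℕ` valuation, PROVED `≠ ⊤`).

Nothing here is a BSD input and BSD is NOT proved by any of this: the research content (existence of the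
T3.1–T3.4 identities with constants of local type = HARDEST (a)) is untouched; this file shows K1 adds no
research beyond it.  No `sorry`, no instance, no notation.
-/

set_option autoImplicit false
set_option linter.dupNamespace false

namespace Summit.BirchSwinnertonDyer.BirchSwinnertonDyer.Cruxes.SplitBadTwoLowerHalfOfFacts.StubIdeasK1G9

/-! ### §A  The local datum at `v ∣ 2`: keys, `δ`, `n_v`, the unit character `(d,·)₂|ℤ₂ˣ` -/

/-- The six dyadic keys of `cm7^{(d)}`, `d ≢ 1 (4)` squarefree (as in k1-g8 §A). -/
inductive DyadicKey
  | k17 | k13 | k01 | k07 | k03 | k05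
  deriving DecidableEq, Repr, Fintype

/-- The three possible restrictions of `ψ_{W,v}·χ_d` to `𝒪_vˣ = ℤ₂ˣ`: `χ₋₄` (conductor `4`), `χ₈`, `χ₋₈`
(conductor `8`).  (`ψ_{cm7,v}` itself is unramified at `v`: `49a` is good at `2`.) -/
inductive LocSym
  | m4 | p8 | m8
  deriving DecidableEq, Repr, Fintype

namespace LocSym

/-- value on an odd residue `u mod 8` (`0` on even input = junk). -/
def val : LocSym → ℤ → ℤ
  | m4, u => if u % 8 = 1 ∨ u % 8 = 5 then 1 else if u % 8 = 3 ∨ u % 8 = 7 then -1 else 0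
  | p8, u => if u % 8 = 1 ∨ u % 8 = 7 then 1 else if u % 8 = 3 ∨ u % 8 = 5 then -1 else 0
  | m8, u => if u % 8 = 1 ∨ u % 8 = 3 then 1 else if u % 8 = 5 ∨ u % 8 = 7 then -1 else 0

/-- conductor exponent of the unit character (`4 = 2²`, `8 = 2³`). -/
def condExp : LocSym → ℕ
  | m4 => 2 | p8 => 3 | m8 => 3

end LocSym

namespace DyadicKey

/-- square-class representative of `d` in `ℚ₂ˣ/ℚ₂ˣ²`. -/
def rep : DyadicKey → ℤ
  | k17 => 7 | k13 => 3 | k01 => 2 | k07 => 14 | k03 => 6 | k05 => 10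

/-- `δ(k) ∈ {−1, 2, −2}` (k1-g8): the twist making the partner GOOD at `2`. -/
def delta : DyadicKey → ℤ
  | k17 => -1 | k13 => -1 | k01 => 2 | k05 => 2 | k07 => -2 | k03 => -2

/-- `n_v(k)`: the `v`-conductor exponent of `ψ_{W,v}` (k1-g8 table). -/
def nv : DyadicKey → ℕ
  | k17 => 2 | k13 => 2 | k01 => 3 | k05 => 3 | k07 => 3 | k03 => 3

/-- the unramified partner (twist by the class of `5`). -/
def unr : DyadicKey → DyadicKey
  | k17 => k13 | k13 => k17 | k01 => k05 | k05 => k01 | k07 => k03 | k03 => k07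

/-- `v₂(rep k) ∈ {0,1}` and the odd part of `rep k`. -/
def twoAdicVal : DyadicKey → ℕ
  | k17 => 0 | k13 => 0 | k01 => 1 | k05 => 1 | k07 => 1 | k03 => 1

def oddPart : DyadicKey → ℤ
  | k17 => 7 | k13 => 3 | k01 => 1 | k05 => 5 | k07 => 7 | k03 => 3

/-- THE LOCAL DATUM: restriction of the local character of the member to `ℤ₂ˣ`. -/
def loc : DyadicKey → LocSym
  | k17 => .m4 | k13 => .m4 | k01 => .p8 | k05 => .p8 | k07 => .m8 | k03 => .m8

end DyadicKey

/-- sign `(−1)^n`. -/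
def sgn (n : ℕ) : ℤ := if n % 2 = 0 then 1 else -1

/-- Serre's bits `ε(u) = (u−1)/2 mod 2`, `ω(u) = (u²−1)/8 mod 2` (odd `u`). -/
def epsBit (u : ℤ) : ℕ := ((u - 1) / 2 % 2).toNat

def omegaBit (u : ℤ) : ℕ := ((u ^ 2 - 1) / 8 % 2).toNat

/-- `(2^α d', w)₂ = (−1)^{ε(d')ε(w) + α ω(w)}` for `w` odd (Hilbert symbol at `2`, `β = 0`;
Serre, *Cours d'arithmétique* III.1.2 Thm 1 = Harari 2017 Ex. 9.11). -/
def hilbertTwoOdd (α : ℕ) (d' w : ℤ) : ℤ := sgn (epsBit d' * epsBit w + α * omegaBit w)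

/-- the unit character of the member of key `k`: `w ↦ (d, w)₂` on odd `w` = `(χ_d ∘ N)_v |_{ℤ₂ˣ}` by local
class field theory (the norm-residue symbol of `ℚ₂(√d)/ℚ₂` is `(d,·)₂`). -/
def DyadicKey.unitChar (k : DyadicKey) (w : ℤ) : ℤ := hilbertTwoOdd k.twoAdicVal k.oddPart w

open DyadicKey

/-- PROVED: the unit character is the tabulated symbol `χ₋₄ / χ₈ / χ₋₈` of `loc k` on the odd residues. -/
theorem unitChar_eq_loc_val (k : DyadicKey) :
    ∀ w : Fin 8, (w.val % 2 = 1) → k.unitChar w.val = k.loc.val w.val := by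
  cases k <;> decide

/-- PROVED (δ-invariance of the local datum, structural form): the unramified partner has the SAME unit
character, as functions on all of `ℤ` — `ε(7) = ε(3)`, `ε(1) = ε(5)` and the `2`-adic valuation is unchanged. -/
theorem unitChar_unr (k : DyadicKey) : (unr k).unitChar = k.unitChar := by
  cases k <;> rfl

theorem loc_unr (k : DyadicKey) : (unr k).loc = k.loc := by cases k <;> rfl

theorem nv_unr (k : DyadicKey) : (unr k).nv = k.nv := by cases k <;> rfl

/-- PROVED: `loc` and `δ` induce the SAME partition of the six keys (three classes of two). -/
theorem loc_eq_iff_delta_eq (k k' : DyadicKey) : k.loc = k'.loc ↔ k.delta = k'.delta := by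
  cases k <;> cases k' <;> decide

/-- PROVED: the conductor exponent of the local datum is the plan's `n_v` table (R70 (iii), value half). -/
theorem condExp_loc (k : DyadicKey) : k.loc.condExp = k.nv := by cases k <;> rfl

/-! ### §B  LOCAL TYPE ⟹ δ-RIGIDITY (and conversely): the provable form of K1 -/

section LocalType

variable {M : Type*} (key : M → DyadicKey)

/-- A digit family `κ` on the class is of LOCAL TYPE (at `v`): it factors through the local datum. -/
def IsLocalType (κ : M → ℤ) : Prop := ∃ Φ : LocSym → ℤ, ∀ W, κ W = Φ (key W).loc

/-- δ-rigidity of a family (k1-g8's `DeltaRigid`, per family). -/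
def IsDeltaRigid (κ : M → ℤ) : Prop := ∀ W W', (key W).delta = (key W').delta → κ W = κ W'

variable {key}

/-- PROVED: local type ⟹ δ-rigid. -/
theorem IsLocalType.isDeltaRigid {κ : M → ℤ} (h : IsLocalType key κ) : IsDeltaRigid key κ := by
  obtain ⟨Φ, hΦ⟩ := h
  intro W W' hδ
  rw [hΦ W, hΦ W', (loc_eq_iff_delta_eq _ _).2 hδ]

/-- PROVED: δ-rigid ⟹ local type (so the two notions COINCIDE on this class: local type is not a weakening of
the conclusion, it is the REASON — the form in which K1 is provable family by family). -/
theorem IsDeltaRigid.isLocalType {κ : M → ℤ} (h : IsDeltaRigid key κ) : IsLocalType key κ := by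
  classical
  refine ⟨fun s => if hs : ∃ W, (key W).loc = s then κ hs.choose else 0, fun W => ?_⟩
  have hs : ∃ W', (key W').loc = (key W).loc := ⟨W, rfl⟩
  show κ W = (if hs' : ∃ W', (key W').loc = (key W).loc then κ hs'.choose else 0)
  rw [dif_pos hs]
  exact h W hs.choose ((loc_eq_iff_delta_eq _ _).1 hs.choose_spec.symm)

theorem isLocalType_iff_isDeltaRigid (κ : M → ℤ) : IsLocalType key κ ↔ IsDeltaRigid key κ :=
  ⟨IsLocalType.isDeltaRigid, IsDeltaRigid.isLocalType⟩

/-- closure: constants, sums, negatives, finite sums — the NET digit is assembled family by family. -/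
theorem isLocalType_const (c : ℤ) : IsLocalType key (fun _ => c) := ⟨fun _ => c, fun _ => rfl⟩

theorem IsLocalType.add {κ₁ κ₂ : M → ℤ} (h₁ : IsLocalType key κ₁) (h₂ : IsLocalType key κ₂) :
    IsLocalType key (fun W => κ₁ W + κ₂ W) := by
  obtain ⟨Φ₁, h₁⟩ := h₁
  obtain ⟨Φ₂, h₂⟩ := h₂
  exact ⟨fun s => Φ₁ s + Φ₂ s, fun W => by show κ₁ W + κ₂ W = _; rw [h₁ W, h₂ W]⟩

theorem IsLocalType.neg {κ : M → ℤ} (h : IsLocalType key κ) : IsLocalType key (fun W => -κ W) := by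
  obtain ⟨Φ, hΦ⟩ := h
  exact ⟨fun s => -Φ s, fun W => by show -κ W = _; rw [hΦ W]⟩

theorem IsLocalType.sum {ι : Type*} (s : Finset ι) {κ : ι → M → ℤ}
    (h : ∀ i ∈ s, IsLocalType key (κ i)) : IsLocalType key (fun W => ∑ i ∈ s, κ i W) := by
  classical
  induction s using Finset.induction_on with
  | empty => simpa using isLocalType_const (key := key) 0
  | insert a s ha ih =>
    have h' : IsLocalType key (fun W => κ a W + ∑ i ∈ s, κ i W) :=
      (h a (Finset.mem_insert_self a s)).add (ih fun i hi => h i (Finset.mem_insert_of_mem hi))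
    obtain ⟨Φ, hΦ⟩ := h'
    refine ⟨Φ, fun W => ?_⟩
    have hW : κ a W + ∑ i ∈ s, κ i W = Φ (key W).loc := hΦ W
    show ∑ i ∈ insert a s, κ i W = Φ (key W).loc
    rw [Finset.sum_insert ha, hW]

/-- a family that is a function of `n_v` alone (conductor-exponent digits such as (37)'s prefactor
`n_v(k − ½)`, the `2`-part of BDP 2.13's `c^{r+3+2j}`, the level `2^{n_v}` of the measure) is local type. -/
theorem isLocalType_of_nv (f : ℕ → ℤ) : IsLocalType key (fun W => f (key W).nv) :=
  ⟨fun s => f s.condExp, fun W => by show f (key W).nv = f (key W).loc.condExp; rw [condExp_loc]⟩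

/-- a family that is a function of `v₂(d) ∈ {0,1}` alone (the `√|d|` of the period seam) is local type. -/
theorem isLocalType_of_twoAdicVal (f : ℕ → ℤ) : IsLocalType key (fun W => f (key W).twoAdicVal) :=
  ⟨fun s => match s with | .m4 => f 0 | .p8 => f 1 | .m8 => f 1, fun W => by
    show f (key W).twoAdicVal = (match (key W).loc with | .m4 => f 0 | .p8 => f 1 | .m8 => f 1)
    cases key W <;> rfl⟩

/-- THE FACTORISED NET DIGIT (Plan 2): `e(W) = Σ_i κ_i(W) + odd(W) − odd(W)`-style bookkeeping — the raw
constant splits into finitely many `2`-LOCAL families and the explicitly booked ODD-place digits (B17's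
`V(d)`, `c_q`, Legendre signs, Pal's `u_q`), which are moved into the member ledger `s(W)`; what is left is
local type, hence δ-rigid. -/
theorem isDeltaRigid_net {ι : Type*} (s : Finset ι) {κ : ι → M → ℤ} {raw odd : M → ℤ}
    (hraw : ∀ W, raw W = (∑ i ∈ s, κ i W) + odd W) (hloc : ∀ i ∈ s, IsLocalType key (κ i)) :
    IsDeltaRigid key (fun W => raw W - odd W) := by
  have h : IsLocalType key (fun W => raw W - odd W) := by
    obtain ⟨Φ, hΦ⟩ := IsLocalType.sum s hloc
    refine ⟨Φ, fun W => ?_⟩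
    have hW : ∑ i ∈ s, κ i W = Φ (key W).loc := hΦ W
    show raw W - odd W = Φ (key W).loc
    rw [hraw W, ← hW]; ring
  exact h.isDeltaRigid

end LocalType

/-! ### §C  R70 (i)–(iii) in their STRONGEST PROVABLE form: Tate's local theory over the tree's API
(`Literature.NumberTheory.Automorphic.QuasiChar`, any non-archimedean local field `F`; at `v` one has
`F = K₀,v = ℚ₂`, `χ = ψ_{W,v}·χ_{d,v}` ramified with `a(χ) = n_v ≥ 2`, `ω = χ_{5,v}` unramified quadratic) -/

section TateSide

open MeasureTheory ValuativeRel Literature.NumberTheory.Automorphic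
open Literature.NumberTheory.GaloisRepresentations.IsNonarchimedeanLocalField

variable {F : Type*} [Field F] [TopologicalSpace F]

theorem quasiChar_mul_apply (χ ω : QuasiChar F) (u : Fˣ) : (χ * ω) u = χ u * ω u := rfl

/-- **Digit corollary — PROVED.** For a QUADRATIC `ω` (`ω·ω = 1`, e.g. `χ_{5,v}`) the correction factor
`ω(u)^{k}` of (i) squares to `1`: it is a sign, so the `ε`/Gauss DIGIT (its valuation at any prime of any
number field containing the values) is EXACTLY δ-invariant, whatever its value. -/
theorem twistFactor_sq_eq_one {ω : QuasiChar F} (hω2 : ω * ω = 1) (u : Fˣ) (k : ℤ) :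
    (((ω u : ℂˣ) : ℂ) ^ k) ^ 2 = 1 := by
  have h1 : (ω * ω) u = 1 := by rw [hω2]; rfl
  rw [quasiChar_mul_apply] at h1
  have h2 : ((ω u : ℂˣ) : ℂ) * ((ω u : ℂˣ) : ℂ) = 1 := by
    rw [← Units.val_mul, h1, Units.val_one]
  rw [← zpow_natCast, ← zpow_mul, mul_comm, zpow_mul, zpow_natCast, pow_two, h2, one_zpow]

variable [ValuativeRel F] [IsNonarchimedeanLocalField F]

/-- **(iii) `n_v` invariance — PROVED.** Twisting by an unramified quasi-character does not change the
conductor exponent: `ω ≡ 1` on `𝒪ˣ ⊇ U^b` for every `b`. -/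
theorem hasConductorExp_mul_of_isUnramified {χ ω : QuasiChar F} {c : ℕ}
    (hχ : χ.HasConductorExp c) (hω : ω.IsUnramified) : (χ * ω).HasConductorExp c := by
  refine ⟨fun x hx => ?_, fun b hb => ?_⟩
  · rw [quasiChar_mul_apply, hχ.1 x hx, hω x hx.1, one_mul]
  · obtain ⟨x, hx, hne⟩ := hχ.2 b hb
    exact ⟨x, hx, by rwa [quasiChar_mul_apply, hω x hx.1, mul_one]⟩

/-- **(ii) ramified stays ramified — PROVED.** -/
theorem not_isUnramified_mul_of_isUnramified {χ ω : QuasiChar F} (hχ : ¬ χ.IsUnramified)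
    (hω : ω.IsUnramified) : ¬ (χ * ω).IsUnramified := by
  intro h
  apply hχ
  intro x hx
  have h1 := h x hx
  rwa [quasiChar_mul_apply, hω x hx, mul_one] at h1

/-- **(ii) Euler-at-`v` = 1 on both members of a δ-pair — PROVED** (`P_χ = 1` for ramified `χ`, tree lemma
`tateEulerFactor_of_not_isUnramified`). -/
theorem tateEulerFactor_mul_of_isUnramified {χ ω : QuasiChar F} (hχ : ¬ χ.IsUnramified)
    (hω : ω.IsUnramified) : tateEulerFactor (χ * ω) = 1 ∧ tateEulerFactor χ = 1 :=
  ⟨tateEulerFactor_of_not_isUnramified (not_isUnramified_mul_of_isUnramified hχ hω),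
    tateEulerFactor_of_not_isUnramified hχ⟩

variable [MeasurableSpace F] [BorelSpace F]

/-- **(i) ε / Gauss under an unramified twist — the strongest provable form (named statement; width task).**
For `ψ` of conductor exponent `m`, `χ` ramified of conductor exponent `c ≥ 1` and `ω` unramified:
`ε(s, χω, ψ) = ω(ϖ)^{c−m} · ε(s, χ, ψ)` — same exponent `c − m`, constant multiplied by `ω(ϖ)^{c−m}`
(independent of the uniformiser since `ω` is unramified).  Print: Kudla (Gelbart–de Shalit eds.),
Prop. 3.8(ii) with (3.28)/(3.32): the Gauss sum `𝔤(χ,ψ) = q^{(ν+c)/2}∫_{𝒪ˣ} χ⁻¹(y)ψ(ϖ^{−ν−c}y)dy` depends on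
`χ|_{𝒪ˣ}` only, the prefactor is `χ(ϖ^{ν+c})`; Deligne 1973 (5.5.3); Tate, Corvallis (3.4.5).  Proof route in
the tree: `hasTateEpsilon_of_hasConductorExp` for `χ` and for `χω` (conductor `c` by
`hasConductorExp_mul_of_isUnramified`), `extend_eq_pow_of_mem_shell`-type evaluation of `ω⁻¹` on the shell
`‖x‖ = q^{−(m−c)}`, and `existsUnique_hasTateEpsilon_holds`. -/
def epsilon_mul_of_isUnramified : Prop :=
  ∀ (ψ : AddChar F Circle) (μ : Measure F) [μ.IsAddHaarMeasure] (μ' : Measure Fˣ) [μ'.IsHaarMeasure]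
    (χ ω : QuasiChar F) (m : ℤ) (c : ℕ) (e : ℂ) (ϖ : F) (hϖ : (valuation F).IsUniformizer ϖ),
    ψ.IsContinuousNontrivial → ψ.HasConductorExp m → χ.HasConductorExp c → 1 ≤ c → ω.IsUnramified →
    HasTateEpsilon ψ μ μ' χ e ((c : ℤ) - m) →
    HasTateEpsilon ψ μ μ' (χ * ω)
      ((((ω (Units.mk0 ϖ hϖ.ne_zero) : ℂˣ) : ℂ) ^ ((c : ℤ) - m)) * e) ((c : ℤ) - m)


end TateSide

/-! ### §D  The WEAKEST SUFFICIENT form for the `≤`-half: one-sided floor from the anchor; SHAPE⁺ -/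

/-- the class ledger of arm M (k1-g8 §C/§E shape) with SHAPE⁺'s explicit non-vanishing flag (R70). -/
structure ClassLedger (M : Type*) where
  key : M → DyadicKey
  /-- analytic side `A(W)` (`ord₂ Ш_an`, K₀-doubled inside `2A`) and algebraic side `B(W)` -/
  A : M → ℤ
  B : M → ℤ
  /-- `g(W)` = half-valuation of the Katz VALUE `G_W(0)`; meaningful only under `NonVanishing W` -/
  g : M → ℤ
  /-- the member's own measurable ledger (log of the generator, index, torsion, the BOOKED odd-place digits) -/
  s : M → ℤ
  /-- the characteristic-series side of T1 -/
  n : M → ℤ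
  /-- the dyadic NET digit (raw constant minus the odd bookings) -/
  e : M → ℤ
  /-- the algebraic per-key constant of T2⁻ / V1 / V2 -/
  cB : DyadicKey → ℤ
  /-- SHAPE⁺ (R70): `G_W(0) ≠ 0` for the member — the non-vanishing every road needs
  (`r_an(W/K₀)`-side: `P` non-torsion ∧ `log_v P ≠ 0` ∧ the value formula at `2`) -/
  NonVanishing : M → Prop

namespace ClassLedger

variable {M : Type*} (L : ClassLedger M)

/-- SHAPE (k1-g8): T3 typed as an EQUALITY with the opaque integer `e`. -/
def Shape : Prop := ∀ W, 2 * L.g W = 2 * L.A W + 2 * L.s W + L.e W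

/-- **SHAPE⁺ (R70): the non-vanishing is an explicit conjunct, not a silent content of K1.** -/
def ShapePlus : Prop := (∀ W, L.NonVanishing W) ∧ L.Shape

/-- the one-sided chain T1⁻ ∘ T2⁻ per member (certificates B-T2, B-V1). -/
def Chain : Prop := ∀ W, L.g W ≤ L.n W ∧ L.n W ≤ L.B W + L.s W + L.cB (L.key W)

/-- **LOWER SEMI-RIGIDITY from a table `T`** — the weakest sufficient form of δ-rigidity for the `≤`-half:
the anchor value is a FLOOR of `e` on its δ-class (B1: larger `e` only helps LOWER). -/
def SemiRigidBelow (T : DyadicKey → ℤ) : Prop := ∀ W, T (L.key W) ≤ L.e W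

theorem shapePlus_shape (h : L.ShapePlus) : L.Shape := h.2

theorem shapePlus_nonVanishing (h : L.ShapePlus) (W : M) : L.NonVanishing W := h.1 W

/-- **PROVED (end-to-end, one-sided):** SHAPE⁺ + chain + a FLOOR table + the slack-3 budget ⟹ LOWER+1.
δ-rigidity (an equality law) is NOT needed for the `≤`-half — only `T(δ) ≤ e`. -/
theorem lowerSucc_of_semiRigidBelow (T : DyadicKey → ℤ) (hS : L.ShapePlus) (hC : L.Chain)
    (hR : L.SemiRigidBelow T) (hbudget : ∀ k, 2 * L.cB k ≤ T k + 3) :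
    ∀ W, L.A W ≤ L.B W + 1 := by
  intro W
  have h1 := hS.2 W
  have h2 := hC W
  have h3 := hR W
  have h4 := hbudget (L.key W)
  omega

/-- slack-1 twin through T0 alone (without R1's Cassels–Tate over `K`). -/
theorem lower_of_semiRigidBelow (T : DyadicKey → ℤ) (hS : L.ShapePlus) (hC : L.Chain)
    (hR : L.SemiRigidBelow T) (hbudget : ∀ k, 2 * L.cB k ≤ T k + 1) :
    ∀ W, L.A W ≤ L.B W := by
  intro W
  have h1 := hS.2 W
  have h2 := hC W
  have h3 := hR W
  have h4 := hbudget (L.key W)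
  omega

/-- **Split `e = e_LT + e_res`** (Plan 3): the local-type part is CALIBRATED EXACTLY at the anchors (k1-g8's
`table_of_deltaRigid`, here consumed as `hT₀`), the residual part only needs a per-key FLOOR `r`. -/
theorem semiRigidBelow_of_localType_add_res {eLT eRes : M → ℤ} (he : ∀ W, L.e W = eLT W + eRes W)
    (T₀ : DyadicKey → ℤ) (hT₀ : ∀ W, eLT W = T₀ (L.key W))
    (r : DyadicKey → ℤ) (hres : ∀ W, r (L.key W) ≤ eRes W) :
    L.SemiRigidBelow (fun k => T₀ k + r k) := by
  intro W
  have h1 := he W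
  have h2 := hT₀ W
  have h3 := hres W
  show T₀ (L.key W) + r (L.key W) ≤ L.e W
  omega

/-- **Unit-at-anchor — PROVED:** an INTEGRAL residual family (`0 ≤ e_res`, e.g. `ord₂` of an algebraic-integer
normalisation entering with `+` sign) has the floor `0` for free; if moreover it VANISHES at the anchor, the
anchor measurement already reads `T = T₀ + 0`, so no rigidity statement about it is ever needed for LOWER. -/
theorem floor_zero_of_nonneg {eRes : M → ℤ} (h : ∀ W, 0 ≤ eRes W) :
    ∀ W, (fun _ : DyadicKey => (0 : ℤ)) (L.key W) ≤ eRes W := fun W => h W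

/-- and the exact calibration of the local-type part from δ-rigidity + one anchor per δ-class (k1-g8 logic,
restated for `IsLocalType`). -/
theorem table_of_isLocalType {eLT : M → ℤ} (h : IsLocalType L.key eLT) (T₀ : DyadicKey → ℤ)
    (hT₀ : ∀ k, T₀ k.unr = T₀ k)
    (anchor : ∀ W, ∃ W₀, (L.key W₀ = L.key W ∨ L.key W₀ = (L.key W).unr) ∧ eLT W₀ = T₀ (L.key W₀)) :
    ∀ W, eLT W = T₀ (L.key W) := by
  intro W
  obtain ⟨W₀, hk, hv⟩ := anchor W
  have hrig := h.isDeltaRigid W W₀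
  rcases hk with hk | hk
  · rw [hrig (by rw [hk]), hv, hk]
  · have hδ : (L.key W).delta = (L.key W₀).delta := by
      rw [hk]; cases L.key W <;> rfl
    rw [hrig hδ, hv, hk, hT₀]

end ClassLedger

/-! ### SHAPE⁺'s non-vanishing, derived form (abstract; the formula `G = u·ℓ²` is HARDEST (a)) -/

section NonVanishing

/-- `G_W(0) = u · (log_v P)² ≠ 0` from a unit `u ≠ 0` and `log_v P ≠ 0`. -/
theorem ne_zero_of_eq_mul_sq {R : Type*} [Field R] {G u ℓ : R} (hG : G = u * ℓ ^ 2) (hu : u ≠ 0)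
    (hℓ : ℓ ≠ 0) : G ≠ 0 := by
  rw [hG]
  exact mul_ne_zero hu (pow_ne_zero 2 hℓ)

/-- `log_v P ≠ 0` for a non-torsion `P` from «the kernel of the (linearly extended) formal-group logarithm is
the torsion» (Silverman AEC IV.6.4) — the stub binder `¬ IsOfFinAddOrder P` is exactly what is consumed. -/
theorem log_ne_zero_of_not_isOfFinAddOrder {E R : Type*} [AddCommGroup E] [Zero R] (log : E → R)
    (hker : ∀ P, log P = 0 → IsOfFinAddOrder P) {P : E} (hP : ¬ IsOfFinAddOrder P) : log P ≠ 0 :=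
  fun h => hP (hker P h)

end NonVanishing

/-! ### §E  R58, re-typing half (T1-AT arm, k1-g7's R2/R3): EQUALITY + SIGNED DEFECT instead of an inequality;
finiteness as a CONCLUSION of control (valuation shadow; the `ℝ`-norm form of k1-g7 follows by monotonicity) -/

section AnchorRetyping

/-- **R3′ (Katz-currency EQUALITY with the defect binder `δ`).** At every anchor `N ≥ N₀`:
`2·ord₂ G(a_N) + δ_N = 2(s_N + cA_N) + e_M` — `δ_N` is the integral defect of the rank-one ε-isomorphism at `v`
(k2-g8's located gap G1: Venjakob 2013 excludes `−1 ∈ G`; the RATIONAL statement is Nakamura 2017 Thm 1.3, any `p`). -/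
def AnchorTNCEq (m s cA : ℕ → ℤ) (eM : ℤ) (δ : ℕ → ℤ) (N₀ : ℕ) : Prop :=
  ∀ N, N₀ ≤ N → 2 * m N + δ N = 2 * (s N + cA N) + eM

/-- **G1-into = the WHOLE research content LOWER consumes of R3: the defect has a SIGN.** -/
def DefectNonneg (δ : ℕ → ℤ) (N₀ : ℕ) : Prop := ∀ N, N₀ ≤ N → 0 ≤ δ N

/-- PROVED: R3′ ∧ sign ⟹ k1-g7's one-sided R3 (`AnchorTNCLower` in digits: `2·ord₂ G(a_N) ≤ 2(s_N + cA_N) + e_M`). -/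
theorem anchorTNCLower_of_eq_of_nonneg {m s cA : ℕ → ℤ} {eM : ℤ} {δ : ℕ → ℤ} {N₀ : ℕ}
    (hEq : AnchorTNCEq m s cA eM δ N₀) (hδ : DefectNonneg δ N₀) :
    ∀ N, N₀ ≤ N → 2 * m N ≤ 2 * (s N + cA N) + eM := by
  intro N hN
  have h1 := hEq N hN
  have h2 := hδ N hN
  omega

/-- and conversely the one-sided statement IS an equality with a non-negative defect (so R3′ + sign is EXACTLY as
strong as R3 — the re-typing loses nothing and names the research digit). -/
theorem eq_with_nonneg_defect_of_lower {m s cA : ℕ → ℤ} {eM : ℤ} {N₀ : ℕ}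
    (h : ∀ N, N₀ ≤ N → 2 * m N ≤ 2 * (s N + cA N) + eM) :
    ∃ δ : ℕ → ℤ, AnchorTNCEq m s cA eM δ N₀ ∧ DefectNonneg δ N₀ :=
  ⟨fun N => 2 * (s N + cA N) + eM - 2 * m N,
    fun N _ => by show 2 * m N + (2 * (s N + cA N) + eM - 2 * m N) = 2 * (s N + cA N) + eM; ring,
    fun N hN => by have := h N hN; show (0 : ℤ) ≤ 2 * (s N + cA N) + eM - 2 * m N; omega⟩

/-- **R2′ (twisted in-range control with FINITENESS AS A CONCLUSION).** The valuation of `H(a_N)` is recorded in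
`WithTop ℕ` (`⊤` = `H(a_N) = 0` = infinite twisted Selmer group); R2′ asserts the finite value outright. -/
def TwistedControlFinite (hOrd : ℕ → WithTop ℕ) (s cM : ℕ → ℕ) : Prop :=
  ∀ N, hOrd N = ((s N + cM N : ℕ) : WithTop ℕ)

/-- PROVED: under R2′ the twisted Selmer group at every anchor is finite (`H(a_N) ≠ 0`) — a conclusion, not a
hypothesis (k1-g7's R2 had `H(a_N) ≠ 0 → …`). -/
theorem twistedControlFinite_ne_top {hOrd : ℕ → WithTop ℕ} {s cM : ℕ → ℕ}
    (h : TwistedControlFinite hOrd s cM) (N : ℕ) : hOrd N ≠ ⊤ := by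
  rw [h N]
  exact WithTop.coe_ne_top

end AnchorRetyping

end Summit.BirchSwinnertonDyer.BirchSwinnertonDyer.Cruxes.SplitBadTwoLowerHalfOfFacts.StubIdeasK1G9
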